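import Literature.NumberTheory.LFunctions.SelbergMollifierSigma2
import HarnessLib

/-!
# Titchmarsh §10.10–10.17: the kernel `g`, `J(x,θ) = ∫_x^∞ |g|² u^{-θ} du`, and (10.17.2)

Sixth support file for the proof of A. Selberg's positive-proportion theorem in the arrangement
of E. C. Titchmarsh, *The Theory of the Riemann Zeta-Function*, 2nd ed. (1986), §10.9–§10.22.
Everything here is PROVED; no named facts.

* §1 `g(u) = ∑_{κ,λ<X} ∑_{m≥1} (β_κβ_λ/λ) exp(-πm²κ²λ⁻²u²(sin δ - i cos δ))` (§10.10; `gfun`), termwise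
  bounds, summability, continuity and the Gaussian majorant `‖g(u)‖ ≤ T e^{-(π sin δ/X²)(u²-1)}`.
* §2 `|g(u)|² = ∑_{p,p'} ∑_{m,n} c_p c_{p'} e^{z(A,B)u²}`, `z = -π(A+B)sin δ + iπ(A-B)cos δ` (§10.11).
* §3 `J(x,θ) = ∫_x^∞ |g|² u^{-θ}` (`Jint`) equals `∑_{p,p'}∑_{m,n} c_pc_{p'} ∫_x^∞ e^{zu²}u^{-θ}`
  (`Jint_eq_Jsum`), and this splits as diagonal + `Σ₂` (`Jsum_eq_diag_add_Sigma2`).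
* §4 The diagonal `mκ/λ = nμ/ν`: `(m,n) = (rb, ra)`, `a = κν/q`, `b = λμ/q`, `q = (κν,λμ)`, so the
  diagonal equals `∑_{p,p'} c_pc_{p'} W(2π(κμ/q)² sin δ)` (`diag_eq_Wsum`) with the `r`-sum `W` of
  `SelbergMollifierThetaSum`.
* §5 (10.11.1) and (10.15.1): by `abs_Wsum_sub_le` the diagonal is
  `S(0)√π/(2θx^θ√(2π sin δ)) + c(θ)(2π sin δ)^{(θ-1)/2} S(θ) + O(x^{1-θ}X²log²X)` with the quadratic
  forms `S(θ) = Squad X θ` of `SelbergMollifierLemma1014` (`diag_main_terms`).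
* §6 **(10.17.2)**: `J(x,θ) ≤ K/(θ x^θ δ^{1/2} log X)` under the side conditions of §10.15–10.16
  (`Jint_le`), from Lemma 10.14 (`Squad_le`) and (10.16.1) (`norm_Sigma2_le`).

## References

* [Titchmarsh1986] E. C. Titchmarsh, *The Theory of the Riemann Zeta-Function*, 2nd ed. revised by
  D. R. Heath-Brown, Oxford 1986, §10.10, §10.11 (10.11.1), §10.15 (10.15.1), §10.17 (10.17.2).
-/

noncomputable section

open Real Complex MeasureTheory Set Filter Finset
open scoped Topology ComplexConjugate

namespace Literature.NumberTheory.LFunctions.SelbergMollifier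

/-! ## §1 The kernel `g` -/

/-- The phase `z₀(A) = -πA sin δ + iπA cos δ` of one term of `g`. [cite: Titchmarsh1986, §10.10] -/
def gPhase (δ A : ℝ) : ℂ := ((-(π * A * Real.sin δ) : ℝ) : ℂ) + ((π * A * Real.cos δ : ℝ) : ℂ) * I

/-- `re z₀(A) = -πA sin δ`. [folklore] -/
theorem gPhase_re (δ A : ℝ) : (gPhase δ A).re = -(π * A * Real.sin δ) := by
  unfold gPhase
  simp only [Complex.add_re, Complex.ofReal_re, Complex.mul_re, Complex.I_re, Complex.I_im, Complex.ofReal_im]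
  ring

/-- `z₀(A) + conj z₀(B) = z(A,B)`. [folklore] -/
theorem gPhase_add_conj (δ A B : ℝ) : gPhase δ A + conj (gPhase δ B) = oscPhase δ A B := by
  apply Complex.ext
  · simp only [gPhase, oscPhase, Complex.add_re, Complex.ofReal_re, Complex.mul_re, Complex.I_re, Complex.I_im,
      Complex.ofReal_im, Complex.conj_re]
    ring
  · simp only [gPhase, oscPhase, Complex.add_im, Complex.ofReal_im, Complex.mul_im, Complex.I_re, Complex.I_im,
      Complex.ofReal_re, Complex.conj_im]
    ring

/-- One term of `g`: `a_{p,m}(u) = c_p e^{z₀(A_{p,m}) u²}`. [cite: Titchmarsh1986, §10.10] -/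
def gTerm (X δ : ℝ) (p : ℕ × ℕ) (m : ℕ) (u : ℝ) : ℂ :=
  ((gCoeff X p : ℝ) : ℂ) * cexp (gPhase δ (gFreq p m) * ((u ^ 2 : ℝ) : ℂ))

/-- `‖a_{p,m}(u)‖ = |c_p| e^{-πA_{p,m} sin δ · u²}`. [folklore] -/
theorem norm_gTerm (X δ : ℝ) (p : ℕ × ℕ) (m : ℕ) (u : ℝ) :
    ‖gTerm X δ p m u‖ = |gCoeff X p| * Real.exp (-(π * gFreq p m * Real.sin δ) * u ^ 2) := by
  rw [gTerm, norm_mul, Complex.norm_real, Real.norm_eq_abs, norm_cexp_mul_sq, gPhase_re]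

/-- **Titchmarsh's `g`** (§10.10: "Calling the triple sum `g(x)`"):
`g(u) = ∑_{1≤κ,λ<X} ∑_{m≥1} (β_κβ_λ/λ) exp(-πm²κ²λ⁻²u²(sin δ - i cos δ))`. [cite: Titchmarsh1986, §10.10] -/
def gfun (X δ : ℝ) (u : ℝ) : ℂ := ∑ p ∈ mollRange X ×ˢ mollRange X, ∑' m : ℕ, gTerm X δ p m u

section Basic

variable {X δ : ℝ} {p : ℕ × ℕ}

/-- `A_{p,m} ≥ X⁻²` on the mollifier range. [folklore] -/
theorem inv_sq_le_gFreq (hX : 0 < X) (hp : p ∈ mollRange X ×ˢ mollRange X) (m : ℕ) : (X ^ 2)⁻¹ ≤ gFreq p m := by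
  obtain ⟨_, h2⟩ := pos_of_mem_prod hp
  obtain ⟨_, hlX⟩ := lt_of_mem_prod hp
  have h := inv_le_gRoot hp m
  have hl : X⁻¹ ≤ (p.2 : ℝ)⁻¹ := inv_anti₀ h2 hlX.le
  have hr : X⁻¹ ≤ gRoot p m := hl.trans h
  calc (X ^ 2)⁻¹ = X⁻¹ ^ 2 := by rw [inv_pow]
    _ ≤ gRoot p m ^ 2 := pow_le_pow_left₀ (by positivity) hr 2
    _ = gFreq p m := rfl

/-- For `u ≥ 1`: `‖a_{p,m}(u)‖ ≤ |c_p| e^{-πA_{p,m}sin δ} e^{-(π sin δ/X²)(u²-1)}`. [folklore] -/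
theorem norm_gTerm_le (hX : 0 < X) (hδ : 0 < Real.sin δ) (hp : p ∈ mollRange X ×ˢ mollRange X) (m : ℕ)
    {u : ℝ} (hu : 1 ≤ u) :
    ‖gTerm X δ p m u‖ ≤ |gCoeff X p| * Real.exp (-(π * gFreq p m * Real.sin δ)) *
      Real.exp (-(π * Real.sin δ / X ^ 2) * (u ^ 2 - 1)) := by
  rw [norm_gTerm]
  have hA := inv_sq_le_gFreq hX hp m
  have hu2 : 0 ≤ u ^ 2 - 1 := by nlinarith
  have hle : π * Real.sin δ / X ^ 2 ≤ π * gFreq p m * Real.sin δ := by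
    rw [div_eq_mul_inv]
    nlinarith [Real.pi_pos, mul_pos Real.pi_pos hδ]
  have key : Real.exp (-(π * gFreq p m * Real.sin δ) * u ^ 2) ≤
      Real.exp (-(π * gFreq p m * Real.sin δ)) * Real.exp (-(π * Real.sin δ / X ^ 2) * (u ^ 2 - 1)) := by
    rw [← Real.exp_add]
    exact Real.exp_le_exp.mpr (by nlinarith [mul_le_mul_of_nonneg_right hle hu2])
  calc _ ≤ |gCoeff X p| * (Real.exp (-(π * gFreq p m * Real.sin δ)) *
        Real.exp (-(π * Real.sin δ / X ^ 2) * (u ^ 2 - 1))) := mul_le_mul_of_nonneg_left key (abs_nonneg _)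
    _ = _ := by ring

/-- The constants `T_p = ∑_m |c_p| e^{-πA_{p,m} sin δ}`. [folklore] -/
def gMajor (X δ : ℝ) (p : ℕ × ℕ) : ℝ := ∑' m : ℕ, |gCoeff X p| * Real.exp (-(π * gFreq p m * Real.sin δ))

/-- Summability of the majorant series. [folklore] -/
theorem summable_gMajor (hδ : 0 < Real.sin δ) (hp : p ∈ mollRange X ×ˢ mollRange X) :
    Summable fun m : ℕ ↦ |gCoeff X p| * Real.exp (-(π * gFreq p m * Real.sin δ)) :=
  (summable_exp_gFreq hδ hp).mul_left _

/-- `T_p ≥ 0`. [folklore] -/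
theorem gMajor_nonneg (X δ : ℝ) (p : ℕ × ℕ) : 0 ≤ gMajor X δ p := tsum_nonneg fun _ ↦ by positivity

/-- **Summability of the terms of `g`** (`u ≥ 1`). [folklore] -/
theorem summable_gTerm (hX : 0 < X) (hδ : 0 < Real.sin δ) (hp : p ∈ mollRange X ×ˢ mollRange X) {u : ℝ} (hu : 1 ≤ u) :
    Summable fun m : ℕ ↦ gTerm X δ p m u := by
  have hc : 0 < π * Real.sin δ / X ^ 2 := div_pos (mul_pos Real.pi_pos hδ) (pow_pos hX 2)
  have hu2 : 0 ≤ u ^ 2 - 1 := by nlinarith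
  have hexp1 : Real.exp (-(π * Real.sin δ / X ^ 2) * (u ^ 2 - 1)) ≤ 1 :=
    Real.exp_le_one_iff.mpr (by nlinarith [mul_nonneg hc.le hu2])
  refine Summable.of_norm (Summable.of_nonneg_of_le (fun _ ↦ norm_nonneg _) (fun m ↦ ?_) (summable_gMajor hδ hp))
  refine (norm_gTerm_le hX hδ hp m hu).trans ?_
  calc _ ≤ |gCoeff X p| * Real.exp (-(π * gFreq p m * Real.sin δ)) * 1 :=
        mul_le_mul_of_nonneg_left hexp1 (by positivity)
    _ = _ := mul_one _

/-- Summability of the norms. [folklore] -/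
theorem summable_norm_gTerm (hX : 0 < X) (hδ : 0 < Real.sin δ) (hp : p ∈ mollRange X ×ˢ mollRange X) {u : ℝ}
    (hu : 1 ≤ u) : Summable fun m : ℕ ↦ ‖gTerm X δ p m u‖ :=
  (summable_gTerm hX hδ hp hu).norm

/-- **The Gaussian majorant of one `p`-block**: `‖∑_m a_{p,m}(u)‖ ≤ T_p e^{-(π sin δ/X²)(u²-1)}` (`u ≥ 1`).
[folklore] -/
theorem norm_tsum_gTerm_le (hX : 0 < X) (hδ : 0 < Real.sin δ) (hp : p ∈ mollRange X ×ˢ mollRange X) {u : ℝ}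
    (hu : 1 ≤ u) :
    ‖∑' m : ℕ, gTerm X δ p m u‖ ≤ gMajor X δ p * Real.exp (-(π * Real.sin δ / X ^ 2) * (u ^ 2 - 1)) := by
  refine (norm_tsum_le_tsum_norm (summable_norm_gTerm hX hδ hp hu)).trans ?_
  rw [gMajor, ← tsum_mul_right]
  exact (summable_norm_gTerm hX hδ hp hu).tsum_le_tsum (fun m ↦ norm_gTerm_le hX hδ hp m hu)
    ((summable_gMajor hδ hp).mul_right _)

/-- Each term is continuous in `u`. [folklore] -/
theorem continuous_gTerm (X δ : ℝ) (p : ℕ × ℕ) (m : ℕ) : Continuous (gTerm X δ p m) := by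
  unfold gTerm; fun_prop

/-- **The `p`-block `∑_m a_{p,m}` is continuous on `[1, ∞)`** (uniform convergence). [folklore] -/
theorem continuousOn_tsum_gTerm (hX : 0 < X) (hδ : 0 < Real.sin δ) (hp : p ∈ mollRange X ×ˢ mollRange X) :
    ContinuousOn (fun u : ℝ ↦ ∑' m : ℕ, gTerm X δ p m u) (Ici 1) := by
  refine continuousOn_tsum (fun m ↦ (continuous_gTerm X δ p m).continuousOn) (summable_gMajor hδ hp) ?_
  intro m u hu
  have hu1 : 1 ≤ u := mem_Ici.mp hu
  have hc : 0 < π * Real.sin δ / X ^ 2 := div_pos (mul_pos Real.pi_pos hδ) (pow_pos hX 2)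
  have hu2 : 0 ≤ u ^ 2 - 1 := by nlinarith
  have hexp1 : Real.exp (-(π * Real.sin δ / X ^ 2) * (u ^ 2 - 1)) ≤ 1 :=
    Real.exp_le_one_iff.mpr (by nlinarith [mul_nonneg hc.le hu2])
  refine (norm_gTerm_le hX hδ hp m hu1).trans ?_
  calc _ ≤ |gCoeff X p| * Real.exp (-(π * gFreq p m * Real.sin δ)) * 1 :=
        mul_le_mul_of_nonneg_left hexp1 (by positivity)
    _ = _ := mul_one _

/-- `g` is continuous on `[1, ∞)`. [folklore] -/
theorem continuousOn_gfun (hX : 0 < X) (hδ : 0 < Real.sin δ) : ContinuousOn (gfun X δ) (Ici 1) := by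
  unfold gfun
  exact continuousOn_finsetSum _ fun p hp ↦ continuousOn_tsum_gTerm hX hδ hp

/-- The total majorant `T = ∑_p T_p`. [folklore] -/
def gMajorTot (X δ : ℝ) : ℝ := ∑ p ∈ mollRange X ×ˢ mollRange X, gMajor X δ p

/-- `T ≥ 0`. [folklore] -/
theorem gMajorTot_nonneg (X δ : ℝ) : 0 ≤ gMajorTot X δ := Finset.sum_nonneg fun p _ ↦ gMajor_nonneg X δ p

/-- **`‖g(u)‖ ≤ T e^{-(π sin δ/X²)(u²-1)}`** for `u ≥ 1`. [folklore] -/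
theorem norm_gfun_le (hX : 0 < X) (hδ : 0 < Real.sin δ) {u : ℝ} (hu : 1 ≤ u) :
    ‖gfun X δ u‖ ≤ gMajorTot X δ * Real.exp (-(π * Real.sin δ / X ^ 2) * (u ^ 2 - 1)) := by
  rw [gfun, gMajorTot, Finset.sum_mul]
  exact (norm_sum_le _ _).trans (Finset.sum_le_sum fun p hp ↦ norm_tsum_gTerm_le hX hδ hp hu)

/-- Crude form: `‖g(u)‖ ≤ T e^{c₀} e^{-c₀ u}` with `c₀ = π sin δ/X²`, for `u ≥ 1`. [folklore] -/
theorem norm_gfun_le_exp (hX : 0 < X) (hδ : 0 < Real.sin δ) {u : ℝ} (hu : 1 ≤ u) :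
    ‖gfun X δ u‖ ≤ gMajorTot X δ * Real.exp (π * Real.sin δ / X ^ 2) * Real.exp (-(π * Real.sin δ / X ^ 2) * u) := by
  refine (norm_gfun_le hX hδ hu).trans ?_
  rw [mul_assoc, ← Real.exp_add]
  refine mul_le_mul_of_nonneg_left (Real.exp_le_exp.mpr ?_) (gMajorTot_nonneg X δ)
  have hc : 0 < π * Real.sin δ / X ^ 2 := div_pos (mul_pos Real.pi_pos hδ) (pow_pos hX 2)
  nlinarith [mul_nonneg hc.le (by nlinarith : (0:ℝ) ≤ u ^ 2 - u)]

end Basic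

/-! ## §2 `|g|²` as a double series -/

section Square

variable {X δ : ℝ} {p p' : ℕ × ℕ}

/-- `a_{p,m}(u) conj(a_{p',n}(u)) = c_pc_{p'} e^{z(A,B)u²}`. [cite: Titchmarsh1986, §10.11] -/
theorem gTerm_mul_conj (X δ : ℝ) (p p' : ℕ × ℕ) (m n : ℕ) (u : ℝ) :
    gTerm X δ p m u * conj (gTerm X δ p' n u) =
      ((gCoeff X p * gCoeff X p' : ℝ) : ℂ) * cexp (oscPhase δ (gFreq p m) (gFreq p' n) * ((u ^ 2 : ℝ) : ℂ)) := by
  rw [gTerm, gTerm, map_mul, Complex.conj_ofReal, ← Complex.exp_conj, map_mul, Complex.conj_ofReal,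
    ← gPhase_add_conj, add_mul, Complex.exp_add]
  push_cast
  ring

/-- **`g(u) conj g(u) = ∑_{p,p'} ∑_{(m,n)} c_pc_{p'} e^{z(A_{p,m},A_{p',n})u²}`** (`u ≥ 1`).
[cite: Titchmarsh1986, §10.11] -/
theorem gfun_mul_conj (hX : 0 < X) (hδ : 0 < Real.sin δ) {u : ℝ} (hu : 1 ≤ u) :
    gfun X δ u * conj (gfun X δ u) =
      ∑ p ∈ mollRange X ×ˢ mollRange X, ∑ p' ∈ mollRange X ×ˢ mollRange X, ∑' mn : ℕ × ℕ,
        ((gCoeff X p * gCoeff X p' : ℝ) : ℂ) * cexp (oscPhase δ (gFreq p mn.1) (gFreq p' mn.2) * ((u ^ 2 : ℝ) : ℂ)) := by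
  rw [gfun, map_sum, Finset.sum_mul_sum]
  refine Finset.sum_congr rfl fun p hp ↦ Finset.sum_congr rfl fun p' hp' ↦ ?_
  rw [Complex.conj_tsum]
  have hs1 := summable_norm_gTerm hX hδ hp hu
  have hs2 : Summable fun n : ℕ ↦ ‖conj (gTerm X δ p' n u)‖ := by
    simpa only [Complex.norm_conj] using summable_norm_gTerm hX hδ hp' hu
  rw [tsum_mul_tsum_of_summable_norm hs1 hs2]
  exact tsum_congr fun mn ↦ gTerm_mul_conj X δ p p' mn.1 mn.2 u

/-- `‖g(u)‖² = re(g conj g)` as a real number; here as the complex identity `g conj g = ‖g‖²`. [folklore] -/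
theorem gfun_mul_conj_eq_norm_sq (X δ u : ℝ) : gfun X δ u * conj (gfun X δ u) = ((‖gfun X δ u‖ ^ 2 : ℝ) : ℂ) := by
  rw [Complex.mul_conj, Complex.normSq_eq_norm_sq]

end Square

/-! ## §3 `J(x,θ)` and its series -/

/-- **`J(x,θ) = ∫_x^∞ |g(u)|² u^{-θ} du`** (Titchmarsh §10.11). [cite: Titchmarsh1986, §10.11] -/
def Jint (X δ x θ : ℝ) : ℝ := ∫ u in Ioi x, ‖gfun X δ u‖ ^ 2 * u ^ (-θ)

/-- The integrated terms `c_pc_{p'} ∫_x^∞ e^{z(A,B)u²}u^{-θ} du`. [cite: Titchmarsh1986, §10.11] -/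
def Jterm (X δ x θ : ℝ) (p p' : ℕ × ℕ) (mn : ℕ × ℕ) : ℂ :=
  ((gCoeff X p * gCoeff X p' : ℝ) : ℂ) * oscI (oscPhase δ (gFreq p mn.1) (gFreq p' mn.2)) x θ

/-- The full series `∑_{p,p'} ∑_{(m,n)} Jterm`. [cite: Titchmarsh1986, §10.11] -/
def Jsum (X δ x θ : ℝ) : ℂ :=
  ∑ p ∈ mollRange X ×ˢ mollRange X, ∑ p' ∈ mollRange X ×ˢ mollRange X, ∑' mn : ℕ × ℕ, Jterm X δ x θ p p' mn

section Series

variable {X δ x θ : ℝ} {p p' : ℕ × ℕ}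

/-- The integrand of the `(p,p',m,n)` term. [folklore] -/
def JtermIntegrand (X δ θ : ℝ) (p p' : ℕ × ℕ) (mn : ℕ × ℕ) (u : ℝ) : ℂ :=
  ((gCoeff X p * gCoeff X p' : ℝ) : ℂ) * (cexp (oscPhase δ (gFreq p mn.1) (gFreq p' mn.2) * ((u ^ 2 : ℝ) : ℂ)) *
    ((u ^ (-θ) : ℝ) : ℂ))

/-- `re z(A,B) = -π(A+B) sin δ < 0`. [folklore] -/
theorem oscPhase_re_neg (hδ : 0 < Real.sin δ) (hp : p ∈ mollRange X ×ˢ mollRange X) (hp' : p' ∈ mollRange X ×ˢ mollRange X)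
    (m n : ℕ) : (oscPhase δ (gFreq p m) (gFreq p' n)).re < 0 := by
  rw [oscPhase_re]
  have hA : 0 < gFreq p m := by unfold gFreq; exact pow_pos (gRoot_pos hp m) 2
  have hB : 0 < gFreq p' n := by unfold gFreq; exact pow_pos (gRoot_pos hp' n) 2
  have := mul_pos (mul_pos Real.pi_pos (add_pos hA hB)) hδ
  linarith

/-- `∫ JtermIntegrand = Jterm`. [folklore] -/
theorem integral_JtermIntegrand (X δ x θ : ℝ) (p p' : ℕ × ℕ) (mn : ℕ × ℕ) :
    ∫ u in Ioi x, JtermIntegrand X δ θ p p' mn u = Jterm X δ x θ p p' mn := by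
  rw [Jterm, oscI, ← integral_const_mul]
  rfl

/-- The `L¹` norm of the integrand of the oscillatory integral: `∫_x^∞ ‖e^{zu²}u^{-θ}‖ ≤ e^{re z x²}/(|re z| x)`.
[folklore] -/
theorem integral_norm_oscIntegrand_le {z : ℂ} (hz : z.re < 0) (hx : 1 ≤ x) (hθ : 0 ≤ θ) :
    ∫ u in Ioi x, ‖cexp (z * ((u ^ 2 : ℝ) : ℂ)) * ((u ^ (-θ) : ℝ) : ℂ)‖ ≤ Real.exp (z.re * x ^ 2) / (|z.re| * x) := by
  have hx0 : 0 < x := by linarith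
  have hc : z.re * x < 0 := mul_neg_of_neg_of_pos hz hx0
  calc ∫ u in Ioi x, ‖cexp (z * ((u ^ 2 : ℝ) : ℂ)) * ((u ^ (-θ) : ℝ) : ℂ)‖ ≤ ∫ u in Ioi x, Real.exp (z.re * x * u) := by
        refine setIntegral_mono_on (integrableOn_oscIntegrand hz hx (by linarith)).norm (integrableOn_exp_mul_Ioi hc x)
          measurableSet_Ioi fun u hu ↦ norm_oscIntegrand_le hz hx (by linarith) hu
    _ = Real.exp (z.re * x ^ 2) / (|z.re| * x) := by
        rw [integral_exp_mul_Ioi hc, abs_of_neg hz, show z.re * x * x = z.re * x ^ 2 by ring]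
        have : z.re ≠ 0 := hz.ne
        field_simp

/-- **`L¹` bound for the `(p,p',m,n)` integrand**:
`∫‖·‖ ≤ |c_pc_{p'}| λ²/(π sin δ) · e^{-πA sin δ} e^{-πB sin δ}` (`x ≥ 1`). [folklore] -/
theorem integral_norm_JtermIntegrand_le (hδ : 0 < Real.sin δ) (hx : 1 ≤ x) (hθ : 0 ≤ θ)
    (hp : p ∈ mollRange X ×ˢ mollRange X) (hp' : p' ∈ mollRange X ×ˢ mollRange X) (mn : ℕ × ℕ) :
    ∫ u in Ioi x, ‖JtermIntegrand X δ θ p p' mn u‖ ≤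
      |gCoeff X p * gCoeff X p'| * ((p.2 : ℝ) ^ 2 / (π * Real.sin δ)) *
        (Real.exp (-(π * gFreq p mn.1 * Real.sin δ)) * Real.exp (-(π * gFreq p' mn.2 * Real.sin δ))) := by
  have hx0 : 0 < x := by linarith
  obtain ⟨_, h2⟩ := pos_of_mem_prod hp
  set z := oscPhase δ (gFreq p mn.1) (gFreq p' mn.2) with hz
  have hre : z.re < 0 := oscPhase_re_neg hδ hp hp' _ _
  have hA : 0 < gFreq p mn.1 := by unfold gFreq; exact pow_pos (gRoot_pos hp _) 2
  have hB : 0 < gFreq p' mn.2 := by unfold gFreq; exact pow_pos (gRoot_pos hp' _) 2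
  have hAlow : ((p.2 : ℝ) ^ 2)⁻¹ ≤ gFreq p mn.1 := by
    have h := inv_le_gRoot hp mn.1
    calc ((p.2 : ℝ) ^ 2)⁻¹ = (p.2 : ℝ)⁻¹ ^ 2 := by rw [inv_pow]
      _ ≤ gRoot p mn.1 ^ 2 := pow_le_pow_left₀ (by positivity) h 2
      _ = _ := rfl
  have h1 : ∫ u in Ioi x, ‖JtermIntegrand X δ θ p p' mn u‖ =
      |gCoeff X p * gCoeff X p'| * ∫ u in Ioi x, ‖cexp (z * ((u ^ 2 : ℝ) : ℂ)) * ((u ^ (-θ) : ℝ) : ℂ)‖ := by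
    rw [← integral_const_mul]
    refine setIntegral_congr_fun measurableSet_Ioi fun u _ ↦ ?_
    rw [JtermIntegrand, norm_mul, Complex.norm_real, Real.norm_eq_abs]
  rw [h1, mul_assoc]
  refine mul_le_mul_of_nonneg_left ((integral_norm_oscIntegrand_le hre hx hθ).trans ?_) (abs_nonneg _)
  rw [hz, oscPhase_re, abs_of_neg (by rw [← oscPhase_re, ← hz]; exact hre)]
  -- `e^{re z x²} ≤ e^{-πA s} e^{-πB s}` and `1/(π(A+B) s x) ≤ λ²/(π s)`
  have hexp : Real.exp (-(π * (gFreq p mn.1 + gFreq p' mn.2) * Real.sin δ) * x ^ 2) ≤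
      Real.exp (-(π * gFreq p mn.1 * Real.sin δ)) * Real.exp (-(π * gFreq p' mn.2 * Real.sin δ)) := by
    rw [← Real.exp_add]
    refine Real.exp_le_exp.mpr ?_
    have hx2 : 1 ≤ x ^ 2 := by nlinarith
    nlinarith [mul_pos (mul_pos Real.pi_pos (add_pos hA hB)) hδ]
  have hpos : 0 < π * (gFreq p mn.1 + gFreq p' mn.2) * Real.sin δ * x :=
    mul_pos (mul_pos (mul_pos Real.pi_pos (add_pos hA hB)) hδ) hx0
  have hden : (p.2 : ℝ) ^ 2 / (π * Real.sin δ) ≥ (-(-(π * (gFreq p mn.1 + gFreq p' mn.2) * Real.sin δ)) * x)⁻¹ := by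
    rw [neg_neg, ge_iff_le, inv_le_iff_one_le_mul₀ hpos]
    have hsum : ((p.2 : ℝ) ^ 2)⁻¹ ≤ gFreq p mn.1 + gFreq p' mn.2 := by linarith
    calc (1 : ℝ) = ((p.2 : ℝ) ^ 2 / (π * Real.sin δ)) * (π * ((p.2 : ℝ) ^ 2)⁻¹ * Real.sin δ * 1) := by
          field_simp
      _ ≤ ((p.2 : ℝ) ^ 2 / (π * Real.sin δ)) * (π * (gFreq p mn.1 + gFreq p' mn.2) * Real.sin δ * x) := by
          gcongr
  rw [div_eq_mul_inv]
  calc Real.exp (-(π * (gFreq p mn.1 + gFreq p' mn.2) * Real.sin δ) * x ^ 2) *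
        (-(-(π * (gFreq p mn.1 + gFreq p' mn.2) * Real.sin δ)) * x)⁻¹
      ≤ (Real.exp (-(π * gFreq p mn.1 * Real.sin δ)) * Real.exp (-(π * gFreq p' mn.2 * Real.sin δ))) *
        ((p.2 : ℝ) ^ 2 / (π * Real.sin δ)) := mul_le_mul hexp hden (by rw [neg_neg]; exact (inv_pos.mpr hpos).le) (by positivity)
    _ = _ := by ring

/-- Integrability of the `(p,p',m,n)` integrand on `(x,∞)`, `x ≥ 1`. [folklore] -/
theorem integrableOn_JtermIntegrand (hδ : 0 < Real.sin δ) (hx : 1 ≤ x) (hθ : 0 ≤ θ)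
    (hp : p ∈ mollRange X ×ˢ mollRange X) (hp' : p' ∈ mollRange X ×ˢ mollRange X) (mn : ℕ × ℕ) :
    IntegrableOn (JtermIntegrand X δ θ p p' mn) (Ioi x) := by
  unfold JtermIntegrand
  exact (integrableOn_oscIntegrand (oscPhase_re_neg hδ hp hp' _ _) hx (by linarith)).const_mul _

/-- **Summability of the `L¹` norms** over `(m,n)`. [folklore] -/
theorem summable_integral_norm_JtermIntegrand (hδ : 0 < Real.sin δ) (hx : 1 ≤ x) (hθ : 0 ≤ θ)
    (hp : p ∈ mollRange X ×ˢ mollRange X) (hp' : p' ∈ mollRange X ×ˢ mollRange X) :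
    Summable fun mn : ℕ × ℕ ↦ ∫ u in Ioi x, ‖JtermIntegrand X δ θ p p' mn u‖ := by
  have hprod : Summable fun mn : ℕ × ℕ ↦ Real.exp (-(π * gFreq p mn.1 * Real.sin δ)) *
      Real.exp (-(π * gFreq p' mn.2 * Real.sin δ)) :=
    summable_mul_of_summable_norm (f := fun m : ℕ ↦ Real.exp (-(π * gFreq p m * Real.sin δ)))
      (g := fun n : ℕ ↦ Real.exp (-(π * gFreq p' n * Real.sin δ)))
      ((summable_exp_gFreq hδ hp).norm) ((summable_exp_gFreq hδ hp').norm)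
  exact Summable.of_nonneg_of_le (fun mn ↦ integral_nonneg fun u ↦ norm_nonneg _)
    (fun mn ↦ integral_norm_JtermIntegrand_le hδ hx hθ hp hp' mn) (hprod.mul_left _)

/-- Summability of `Jterm` over `(m,n)`. [folklore] -/
theorem summable_Jterm (hδ : 0 < Real.sin δ) (hx : 1 ≤ x) (hθ : 0 ≤ θ)
    (hp : p ∈ mollRange X ×ˢ mollRange X) (hp' : p' ∈ mollRange X ×ˢ mollRange X) :
    Summable fun mn : ℕ × ℕ ↦ Jterm X δ x θ p p' mn := by
  refine Summable.of_norm (Summable.of_nonneg_of_le (fun _ ↦ norm_nonneg _) (fun mn ↦ ?_)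
    (summable_integral_norm_JtermIntegrand hδ hx hθ hp hp'))
  rw [← integral_JtermIntegrand]
  exact norm_integral_le_integral_norm _

/-- **The series of one `(p,p')` block**: `∫_x^∞ ∑_{(m,n)} c c' e^{zu²}u^{-θ} = ∑_{(m,n)} Jterm`.
[cite: Titchmarsh1986, §10.11] -/
theorem integral_tsum_JtermIntegrand (hδ : 0 < Real.sin δ) (hx : 1 ≤ x) (hθ : 0 ≤ θ)
    (hp : p ∈ mollRange X ×ˢ mollRange X) (hp' : p' ∈ mollRange X ×ˢ mollRange X) :
    ∫ u in Ioi x, ∑' mn : ℕ × ℕ, JtermIntegrand X δ θ p p' mn u = ∑' mn : ℕ × ℕ, Jterm X δ x θ p p' mn := by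
  rw [← integral_tsum_of_summable_integral_norm (integrableOn_JtermIntegrand hδ hx hθ hp hp')
    (summable_integral_norm_JtermIntegrand hδ hx hθ hp hp')]
  exact tsum_congr fun mn ↦ integral_JtermIntegrand X δ x θ p p' mn

end Series

/-! ## §3 (continued) `J(x,θ) = ∑_{p,p'} ∑_{(m,n)} Jterm` -/

section Identity

variable {X δ x θ : ℝ} {p p' : ℕ × ℕ}

/-- The `(p,p')` block of the integrand is the product of the two `p`-blocks of `g`. [folklore] -/
theorem tsum_JtermIntegrand_eq (hX : 0 < X) (hδ : 0 < Real.sin δ) (hp : p ∈ mollRange X ×ˢ mollRange X)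
    (hp' : p' ∈ mollRange X ×ˢ mollRange X) (θ : ℝ) {u : ℝ} (hu : 1 ≤ u) :
    ∑' mn : ℕ × ℕ, JtermIntegrand X δ θ p p' mn u =
      (∑' m : ℕ, gTerm X δ p m u) * conj (∑' n : ℕ, gTerm X δ p' n u) * ((u ^ (-θ) : ℝ) : ℂ) := by
  rw [Complex.conj_tsum]
  have hs1 := summable_norm_gTerm hX hδ hp hu
  have hs2 : Summable fun n : ℕ ↦ ‖conj (gTerm X δ p' n u)‖ := by
    simpa only [Complex.norm_conj] using summable_norm_gTerm hX hδ hp' hu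
  rw [tsum_mul_tsum_of_summable_norm hs1 hs2, ← tsum_mul_right]
  refine tsum_congr fun mn ↦ ?_
  rw [JtermIntegrand, gTerm_mul_conj, mul_assoc]

/-- The `(p,p')` block of the integrand is integrable on `(x,∞)`, `x ≥ 1`. [folklore] -/
theorem integrableOn_tsum_JtermIntegrand (hX : 0 < X) (hδ : 0 < Real.sin δ) (hx : 1 ≤ x) (hθ : 0 ≤ θ)
    (hp : p ∈ mollRange X ×ˢ mollRange X) (hp' : p' ∈ mollRange X ×ˢ mollRange X) :
    IntegrableOn (fun u : ℝ ↦ ∑' mn : ℕ × ℕ, JtermIntegrand X δ θ p p' mn u) (Ioi x) := by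
  have hx0 : 0 < x := by linarith
  set c₀ : ℝ := π * Real.sin δ / X ^ 2 with hc₀
  have hc₀pos : 0 < c₀ := div_pos (mul_pos Real.pi_pos hδ) (pow_pos hX 2)
  set G : ℝ → ℂ := fun u ↦ (∑' m : ℕ, gTerm X δ p m u) * conj (∑' n : ℕ, gTerm X δ p' n u) * ((u ^ (-θ) : ℝ) : ℂ) with hG
  have heq : EqOn (fun u : ℝ ↦ ∑' mn : ℕ × ℕ, JtermIntegrand X δ θ p p' mn u) G (Ioi x) := fun u hu ↦
    tsum_JtermIntegrand_eq hX hδ hp hp' θ (hx.trans (le_of_lt hu))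
  refine IntegrableOn.congr_fun ?_ heq.symm measurableSet_Ioi
  -- `G` is continuous on `[1,∞)` and dominated by a decaying exponential
  have hcont : ContinuousOn G (Ici 1) := by
    refine ContinuousOn.mul (ContinuousOn.mul (continuousOn_tsum_gTerm hX hδ hp) ?_) ?_
    · exact (Complex.continuous_conj.comp_continuousOn (continuousOn_tsum_gTerm hX hδ hp'))
    · exact Complex.continuous_ofReal.comp_continuousOn (continuousOn_id.rpow_const fun u hu ↦
        Or.inl (by linarith [mem_Ici.mp hu] : u ≠ 0))
  set K : ℝ := gMajor X δ p * gMajor X δ p' * Real.exp (2 * c₀) with hK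
  refine Integrable.mono' ((integrableOn_exp_mul_Ioi (a := -(2 * c₀)) (by linarith) x).const_mul K)
    ((hcont.mono (fun u hu ↦ hx.trans (le_of_lt hu))).aestronglyMeasurable measurableSet_Ioi) ?_
  refine (ae_restrict_iff' measurableSet_Ioi).mpr (Eventually.of_forall fun u hu ↦ ?_)
  have hu1 : 1 ≤ u := hx.trans (le_of_lt hu)
  have hb1 := norm_tsum_gTerm_le hX hδ hp hu1
  have hb2 := norm_tsum_gTerm_le hX hδ hp' hu1
  rw [hG]
  simp only
  rw [norm_mul, norm_mul, Complex.norm_conj, Complex.norm_real, Real.norm_eq_abs,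
    abs_of_nonneg (Real.rpow_nonneg (by linarith) _)]
  have hθ1 : u ^ (-θ) ≤ 1 := Real.rpow_le_one_of_one_le_of_nonpos hu1 (by linarith)
  have hee : Real.exp (-(π * Real.sin δ / X ^ 2) * (u ^ 2 - 1)) * Real.exp (-(π * Real.sin δ / X ^ 2) * (u ^ 2 - 1)) ≤
      Real.exp (2 * c₀) * Real.exp (-(2 * c₀) * u) := by
    rw [← Real.exp_add, ← Real.exp_add, hc₀]
    refine Real.exp_le_exp.mpr ?_
    nlinarith [mul_nonneg hc₀pos.le (by nlinarith : (0:ℝ) ≤ u ^ 2 - u)]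
  have hnn1 : 0 ≤ gMajor X δ p * Real.exp (-(π * Real.sin δ / X ^ 2) * (u ^ 2 - 1)) :=
    mul_nonneg (gMajor_nonneg X δ p) (Real.exp_pos _).le
  have hnn2 : 0 ≤ gMajor X δ p' * Real.exp (-(π * Real.sin δ / X ^ 2) * (u ^ 2 - 1)) :=
    mul_nonneg (gMajor_nonneg X δ p') (Real.exp_pos _).le
  calc ‖∑' m : ℕ, gTerm X δ p m u‖ * ‖∑' n : ℕ, gTerm X δ p' n u‖ * u ^ (-θ)
      ≤ (gMajor X δ p * Real.exp (-(π * Real.sin δ / X ^ 2) * (u ^ 2 - 1))) *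
          (gMajor X δ p' * Real.exp (-(π * Real.sin δ / X ^ 2) * (u ^ 2 - 1))) * 1 :=
        mul_le_mul (mul_le_mul hb1 hb2 (norm_nonneg _) hnn1) hθ1 (Real.rpow_nonneg (by linarith) _)
          (mul_nonneg hnn1 hnn2)
    _ = gMajor X δ p * gMajor X δ p' * (Real.exp (-(π * Real.sin δ / X ^ 2) * (u ^ 2 - 1)) *
          Real.exp (-(π * Real.sin δ / X ^ 2) * (u ^ 2 - 1))) := by ring
    _ ≤ gMajor X δ p * gMajor X δ p' * (Real.exp (2 * c₀) * Real.exp (-(2 * c₀) * u)) :=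
        mul_le_mul_of_nonneg_left hee (mul_nonneg (gMajor_nonneg X δ p) (gMajor_nonneg X δ p'))
    _ = K * Real.exp (-(2 * c₀) * u) := by rw [hK]; ring

/-- **`J(x,θ) = ∑_{p,p'} ∑_{(m,n)} c_pc_{p'} ∫_x^∞ e^{zu²}u^{-θ} du`** (Titchmarsh §10.11: "This is equal to
`∑_m ∑_n ∑_{κλμν} …`"). [cite: Titchmarsh1986, §10.11] -/
theorem Jint_eq_Jsum (hX : 0 < X) (hδ : 0 < Real.sin δ) (hx : 1 ≤ x) (hθ : 0 ≤ θ) :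
    ((Jint X δ x θ : ℝ) : ℂ) = Jsum X δ x θ := by
  rw [Jint, ← integral_complex_ofReal]
  have hpt : EqOn (fun u : ℝ ↦ (((‖gfun X δ u‖ ^ 2 * u ^ (-θ) : ℝ)) : ℂ))
      (fun u : ℝ ↦ ∑ p ∈ mollRange X ×ˢ mollRange X, ∑ p' ∈ mollRange X ×ˢ mollRange X,
        ∑' mn : ℕ × ℕ, JtermIntegrand X δ θ p p' mn u) (Ioi x) := by
    intro u hu
    have hu1 : 1 ≤ u := hx.trans (le_of_lt hu)
    simp only
    rw [Complex.ofReal_mul, ← gfun_mul_conj_eq_norm_sq, gfun_mul_conj hX hδ hu1, Finset.sum_mul]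
    refine Finset.sum_congr rfl fun p hp ↦ ?_
    rw [Finset.sum_mul]
    refine Finset.sum_congr rfl fun p' hp' ↦ ?_
    rw [← tsum_mul_right]
    exact tsum_congr fun mn ↦ by simp only [JtermIntegrand]; ring
  rw [setIntegral_congr_fun measurableSet_Ioi hpt, integral_finsetSum _ fun p hp ↦ ?_]
  · refine Finset.sum_congr rfl fun p hp ↦ ?_
    rw [integral_finsetSum _ fun p' hp' ↦ integrableOn_tsum_JtermIntegrand hX hδ hx hθ hp hp']
    exact Finset.sum_congr rfl fun p' hp' ↦ integral_tsum_JtermIntegrand hδ hx hθ hp hp'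
  · exact integrable_finsetSum (μ := volume.restrict (Ioi x)) (mollRange X ×ˢ mollRange X)
      (f := fun p' u ↦ ∑' mn : ℕ × ℕ, JtermIntegrand X δ θ p p' mn u) fun p' hp' ↦
      integrableOn_tsum_JtermIntegrand hX hδ hx hθ hp hp'

/-! ## §4 Diagonal and off-diagonal -/

/-- **The diagonal terms `Σ₁`** (`mκ/λ = nμ/ν`), as complex numbers. [cite: Titchmarsh1986, §10.11] -/
def Jdiag (X δ x θ : ℝ) : ℂ :=
  ∑ p ∈ mollRange X ×ˢ mollRange X, ∑ p' ∈ mollRange X ×ˢ mollRange X, ∑' mn : ℕ × ℕ,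
    if (mn.1 + 1) * p.1 * p'.2 = (mn.2 + 1) * p'.1 * p.2 then Jterm X δ x θ p p' mn else 0

/-- **`J = Σ₁ + Σ₂`.** [cite: Titchmarsh1986, §10.11] -/
theorem Jsum_eq_Jdiag_add_Sigma2 (hδ : 0 < Real.sin δ) (hx : 1 ≤ x) (hθ : 0 ≤ θ) :
    Jsum X δ x θ = Jdiag X δ x θ + Sigma2 X δ x θ := by
  rw [Jsum, Jdiag, Sigma2, ← Finset.sum_add_distrib]
  refine Finset.sum_congr rfl fun p hp ↦ ?_
  rw [← Finset.sum_add_distrib]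
  refine Finset.sum_congr rfl fun p' hp' ↦ ?_
  have hs := (summable_Jterm hδ hx hθ hp hp').norm
  have h1 : Summable fun mn : ℕ × ℕ ↦
      if (mn.1 + 1) * p.1 * p'.2 = (mn.2 + 1) * p'.1 * p.2 then Jterm X δ x θ p p' mn else 0 := by
    refine Summable.of_norm (Summable.of_nonneg_of_le (fun _ ↦ norm_nonneg _) (fun mn ↦ ?_) hs)
    split_ifs
    · exact le_rfl
    · simp
  have h2 : Summable fun mn : ℕ × ℕ ↦ if (mn.1 + 1) * p.1 * p'.2 = (mn.2 + 1) * p'.1 * p.2 then (0 : ℂ)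
      else ((gCoeff X p * gCoeff X p' : ℝ) : ℂ) * oscI (oscPhase δ (gFreq p mn.1) (gFreq p' mn.2)) x θ := by
    refine Summable.of_norm (Summable.of_nonneg_of_le (fun _ ↦ norm_nonneg _) (fun mn ↦ ?_) hs)
    split_ifs
    · simp
    · exact le_of_eq rfl
  rw [← h1.tsum_add h2]
  refine tsum_congr fun mn ↦ ?_
  split_ifs <;> simp [Jterm]

end Identity

/-! ## §5 The diagonal `(m,n) = (rb, ra)` and the `r`-sum `W` -/

section Diagonal

variable {X δ x θ : ℝ} {p p' : ℕ × ℕ}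

/-- The `η` of the diagonal block: `η_{p,p'} = 2π (κμ/q)² sin δ`, `q = (κν, λμ)`. [cite: Titchmarsh1986, §10.11] -/
def etaDiag (δ : ℝ) (p p' : ℕ × ℕ) : ℝ :=
  2 * π * ((p.1 : ℝ) * p'.1 / Nat.gcd (p.1 * p'.2) (p'.1 * p.2)) ^ 2 * Real.sin δ

/-- For a real negative phase the oscillatory integral is the real integral. [folklore] -/
theorem oscI_ofReal {c : ℝ} (x θ : ℝ) :
    oscI ((c : ℝ) : ℂ) x θ = (((∫ u in Ioi x, Real.exp (c * u ^ 2) * u ^ (-θ) : ℝ)) : ℂ) := by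
  rw [oscI, ← integral_complex_ofReal]
  refine setIntegral_congr_fun measurableSet_Ioi fun u _ ↦ ?_
  rw [show ((c : ℝ) : ℂ) * ((u ^ 2 : ℝ) : ℂ) = (((c * u ^ 2 : ℝ)) : ℂ) by push_cast; ring, ← Complex.ofReal_exp]
  push_cast
  ring

/-- On the diagonal the phase is real: `z(A,A) = -2πA sin δ`. [folklore] -/
theorem oscPhase_self (δ A : ℝ) : oscPhase δ A A = (((-(2 * π * A * Real.sin δ)) : ℝ) : ℂ) := by
  apply Complex.ext
  · rw [oscPhase_re, Complex.ofReal_re]; ring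
  · rw [oscPhase_im, Complex.ofReal_im]; ring

/-- **The diagonal block equals `c_pc_{p'} W(η_{p,p'})`** (Titchmarsh §10.11: "in `Σ₁`, `ma = nb`, so that
`n = ra`, `m = rb`"). [cite: Titchmarsh1986, §10.11] -/
theorem diag_block_eq_Wsum (hp : p ∈ mollRange X ×ˢ mollRange X) (hp' : p' ∈ mollRange X ×ˢ mollRange X)
    (δ x θ : ℝ) :
    ∑' mn : ℕ × ℕ, (if (mn.1 + 1) * p.1 * p'.2 = (mn.2 + 1) * p'.1 * p.2 then Jterm X δ x θ p p' mn else 0) =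
      (((gCoeff X p * gCoeff X p' * Wsum (etaDiag δ p p') x θ : ℝ)) : ℂ) := by
  classical
  obtain ⟨h1, h2⟩ := pos_of_mem_prod hp
  obtain ⟨h1', h2'⟩ := pos_of_mem_prod hp'
  have hκ : 0 < p.1 := by exact_mod_cast h1
  have hl : 0 < p.2 := by exact_mod_cast h2
  have hμ : 0 < p'.1 := by exact_mod_cast h1'
  have hν : 0 < p'.2 := by exact_mod_cast h2'
  -- `q, a, b`
  set q : ℕ := Nat.gcd (p.1 * p'.2) (p'.1 * p.2) with hq
  have hq0 : 0 < q := Nat.gcd_pos_of_pos_left _ (by positivity)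
  set a : ℕ := p.1 * p'.2 / q with ha
  set b : ℕ := p'.1 * p.2 / q with hb
  have hqa : q ∣ p.1 * p'.2 := Nat.gcd_dvd_left _ _
  have hqb : q ∣ p'.1 * p.2 := Nat.gcd_dvd_right _ _
  have haq : a * q = p.1 * p'.2 := Nat.div_mul_cancel hqa
  have hbq : b * q = p'.1 * p.2 := Nat.div_mul_cancel hqb
  have ha0 : 0 < a := Nat.pos_of_ne_zero fun h0 ↦ by
    rw [h0, zero_mul] at haq; exact (by positivity : p.1 * p'.2 ≠ 0) haq.symm
  have hb0 : 0 < b := Nat.pos_of_ne_zero fun h0 ↦ by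
    rw [h0, zero_mul] at hbq; exact (by positivity : p'.1 * p.2 ≠ 0) hbq.symm
  have hcop : Nat.Coprime a b := Nat.coprime_div_gcd_div_gcd hq0
  -- the parametrisation of the diagonal
  set φ : ℕ → ℕ × ℕ := fun r ↦ ((r + 1) * b - 1, (r + 1) * a - 1) with hφ
  have hφ1 : ∀ r, (φ r).1 + 1 = (r + 1) * b := fun r ↦ Nat.sub_add_cancel (Nat.mul_pos (Nat.succ_pos r) hb0)
  have hφ2 : ∀ r, (φ r).2 + 1 = (r + 1) * a := fun r ↦ Nat.sub_add_cancel (Nat.mul_pos (Nat.succ_pos r) ha0)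
  have hinj : Function.Injective φ := by
    intro r₁ r₂ h
    have := congrArg (fun mn : ℕ × ℕ ↦ mn.1 + 1) h
    simp only [hφ1] at this
    have := Nat.eq_of_mul_eq_mul_right hb0 this
    omega
  have hdiagφ : ∀ r, ((φ r).1 + 1) * p.1 * p'.2 = ((φ r).2 + 1) * p'.1 * p.2 := by
    intro r
    rw [hφ1, hφ2, mul_assoc, ← haq, mul_assoc ((r + 1) * a), ← hbq]; ring
  set f : ℕ × ℕ → ℂ := fun mn ↦
    if (mn.1 + 1) * p.1 * p'.2 = (mn.2 + 1) * p'.1 * p.2 then Jterm X δ x θ p p' mn else 0 with hf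
  have hsupp : Function.support f ⊆ Set.range φ := by
    intro mn hmn
    rw [Function.mem_support] at hmn
    have hdiag : (mn.1 + 1) * p.1 * p'.2 = (mn.2 + 1) * p'.1 * p.2 := by
      by_contra h; exact hmn (by rw [hf]; simp only; rw [if_neg h])
    -- `(m+1) a = (n+1) b`, so `b ∣ m+1`
    have hab : (mn.1 + 1) * a = (mn.2 + 1) * b := by
      have : (mn.1 + 1) * a * q = (mn.2 + 1) * b * q := by
        rw [mul_assoc, haq, mul_assoc, hbq, ← mul_assoc, ← mul_assoc]; exact hdiag
      exact Nat.eq_of_mul_eq_mul_right hq0 this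
    have hbdvd : b ∣ mn.1 + 1 := by
      have : b ∣ (mn.1 + 1) * a := ⟨mn.2 + 1, by rw [hab]; ring⟩
      exact (hcop.symm.dvd_of_dvd_mul_right this)
    obtain ⟨t, ht⟩ := hbdvd
    have ht0 : 0 < t := Nat.pos_of_ne_zero fun h0 ↦ by rw [h0, mul_zero] at ht; omega
    refine ⟨t - 1, ?_⟩
    have ht1 : t - 1 + 1 = t := Nat.sub_add_cancel ht0
    have hn : mn.2 + 1 = t * a := by
      have : (mn.2 + 1) * b = (t * a) * b := by rw [← hab, ht]; ring
      exact Nat.eq_of_mul_eq_mul_right hb0 this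
    apply Prod.ext
    · show (t - 1 + 1) * b - 1 = mn.1
      rw [ht1, mul_comm]; omega
    · show (t - 1 + 1) * a - 1 = mn.2
      rw [ht1]; omega
  rw [← hinj.tsum_eq hsupp]
  -- evaluate `f (φ r)`
  have hbR : (b : ℝ) = (p'.1 : ℝ) * p.2 / q := by
    rw [eq_div_iff (by positivity)]; exact_mod_cast hbq
  have hval : ∀ r : ℕ, f (φ r) = ((((gCoeff X p * gCoeff X p') *
      ∫ u in Ioi x, Real.exp (-((r : ℝ) + 1) ^ 2 * u ^ 2 * etaDiag δ p p') * u ^ (-θ) : ℝ)) : ℂ) := by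
    intro r
    rw [hf]; simp only; rw [if_pos (hdiagφ r), Jterm]
    have hfreq : gFreq p' (φ r).2 = gFreq p (φ r).1 := by
      have := (diag_iff hp hp' (φ r).1 (φ r).2).mp (hdiagφ r)
      unfold gFreq; rw [this]
    rw [hfreq, oscPhase_self, oscI_ofReal]
    -- `2π A sin δ u² = (r+1)² u² η` with `√A = (m+1)κ/λ = (r+1)κμ/q`
    have hroot : gRoot p (φ r).1 = ((r : ℝ) + 1) * (p.1 * p'.1 / q) := by
      unfold gRoot
      have : (((φ r).1 : ℝ) + 1) = ((r : ℝ) + 1) * b := by exact_mod_cast hφ1 r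
      rw [this, hbR]
      field_simp
    have hint : ∫ u in Ioi x, Real.exp (-(2 * π * gFreq p (φ r).1 * Real.sin δ) * u ^ 2) * u ^ (-θ) =
        ∫ u in Ioi x, Real.exp (-((r : ℝ) + 1) ^ 2 * u ^ 2 * etaDiag δ p p') * u ^ (-θ) := by
      refine setIntegral_congr_fun measurableSet_Ioi fun u _ ↦ ?_
      congr 2
      unfold gFreq; rw [hroot, etaDiag]; ring
    rw [hint]
    push_cast
    ring
  rw [tsum_congr hval, ← Complex.ofReal_tsum, tsum_mul_left, Wsum]

/-- **`Σ₁ = ∑_{p,p'} c_pc_{p'} W(η_{p,p'})`.** [cite: Titchmarsh1986, §10.11] -/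
theorem Jdiag_eq (X δ x θ : ℝ) :
    Jdiag X δ x θ = (((∑ p ∈ mollRange X ×ˢ mollRange X, ∑ p' ∈ mollRange X ×ˢ mollRange X,
      gCoeff X p * gCoeff X p' * Wsum (etaDiag δ p p') x θ : ℝ)) : ℂ) := by
  rw [Jdiag]
  push_cast
  refine Finset.sum_congr rfl fun p hp ↦ Finset.sum_congr rfl fun p' hp' ↦ ?_
  rw [diag_block_eq_Wsum hp hp' δ x θ]
  push_cast
  ring

end Diagonal

/-! ## §6 (10.11.1): the main terms `S(0)`, `S(θ)` -/

section MainTerms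

variable {X δ x θ : ℝ}

/-- Reindexing `(p,p') = ((κ,λ),(μ,ν)) ↦ (P,P') = ((κ,ν),(μ,λ))` of a double sum over pairs. [folklore] -/
theorem sum_pairs_reindex (R : Finset ℕ) (F : ℕ × ℕ → ℕ × ℕ → ℝ) :
    ∑ p ∈ R ×ˢ R, ∑ p' ∈ R ×ˢ R, F (p.1, p'.2) (p'.1, p.2) = ∑ P ∈ R ×ˢ R, ∑ P' ∈ R ×ˢ R, F P P' := by
  simp only [Finset.sum_product]
  refine Finset.sum_congr rfl fun κ _ ↦ ?_
  calc ∑ l ∈ R, ∑ μ ∈ R, ∑ ν ∈ R, F (κ, ν) (μ, l)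
      = ∑ μ ∈ R, ∑ l ∈ R, ∑ ν ∈ R, F (κ, ν) (μ, l) := Finset.sum_comm
    _ = ∑ μ ∈ R, ∑ ν ∈ R, ∑ l ∈ R, F (κ, ν) (μ, l) := Finset.sum_congr rfl fun μ _ ↦ Finset.sum_comm
    _ = ∑ ν ∈ R, ∑ μ ∈ R, ∑ l ∈ R, F (κ, ν) (μ, l) := Finset.sum_comm

/-- The quadratic forms in the `g`-indexing: `∑_{p,p'} c_pc_{p'} (q/κμ)^{1-θ'} = S(θ')`. [cite: Titchmarsh1986, §10.11] -/
theorem sum_gCoeff_ratio_eq_Squad (X θ' : ℝ) :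
    ∑ p ∈ mollRange X ×ˢ mollRange X, ∑ p' ∈ mollRange X ×ˢ mollRange X,
      gCoeff X p * gCoeff X p' * ((Nat.gcd (p.1 * p'.2) (p'.1 * p.2) : ℝ) / ((p.1 : ℝ) * p'.1)) ^ (1 - θ') =
      Squad X θ' := by
  rw [Squad, ← sum_pairs_reindex (mollRange X) (fun P P' ↦
    ((Nat.gcd (P.1 * P.2) (P'.1 * P'.2) : ℝ) / ((P.1 : ℝ) * P'.1)) ^ (1 - θ') *
      (selbergBeta X P.1 * selbergBeta X P.2 * selbergBeta X P'.1 * selbergBeta X P'.2) / ((P.2 : ℝ) * P'.2))]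
  refine Finset.sum_congr rfl fun p _ ↦ Finset.sum_congr rfl fun p' _ ↦ ?_
  simp only [gCoeff]
  ring

/-- `∑_p |c_p| ≤ 2X(1 + log X)` (`X ≥ 1`). [folklore] -/
theorem sum_abs_gCoeff_le (hX : 1 ≤ X) : ∑ p ∈ mollRange X ×ˢ mollRange X, |gCoeff X p| ≤ 2 * X * (1 + Real.log X) := by
  have hX0 : 0 < X := by linarith
  calc ∑ p ∈ mollRange X ×ˢ mollRange X, |gCoeff X p| ≤ ∑ p ∈ mollRange X ×ˢ mollRange X, ((p.2 : ℝ))⁻¹ :=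
        Finset.sum_le_sum fun p hp ↦ (abs_gCoeff_le hp).trans (le_of_eq (one_div _))
    _ = ∑ _κ ∈ mollRange X, ∑ l ∈ mollRange X, (l : ℝ)⁻¹ := by rw [Finset.sum_product]
    _ = (mollRange X).card * ∑ l ∈ mollRange X, (l : ℝ)⁻¹ := by rw [Finset.sum_const, nsmul_eq_mul]
    _ ≤ X * (2 * (1 + Real.log X)) :=
        mul_le_mul (card_mollRange_le hX0.le) (sum_mollRange_inv_le hX)
          (Finset.sum_nonneg fun _ _ ↦ by positivity) hX0.le
    _ = 2 * X * (1 + Real.log X) := by ring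

/-- `η_{p,p'} > 0` and its square root / power in terms of `q/(κμ)`. [folklore] -/
theorem etaDiag_facts (hδ : 0 < Real.sin δ) {p p' : ℕ × ℕ} (hp : p ∈ mollRange X ×ˢ mollRange X)
    (hp' : p' ∈ mollRange X ×ˢ mollRange X) (θ : ℝ) :
    let ρq : ℝ := (Nat.gcd (p.1 * p'.2) (p'.1 * p.2) : ℝ) / ((p.1 : ℝ) * p'.1)
    0 < etaDiag δ p p' ∧ 0 < ρq ∧
      (Real.sqrt (etaDiag δ p p'))⁻¹ = ρq / Real.sqrt (2 * π * Real.sin δ) ∧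
      etaDiag δ p p' ^ ((θ - 1) / 2) = (2 * π * Real.sin δ) ^ ((θ - 1) / 2) * ρq ^ (1 - θ) := by
  intro ρq
  obtain ⟨h1, h2⟩ := pos_of_mem_prod hp
  obtain ⟨h1', h2'⟩ := pos_of_mem_prod hp'
  have hq0 : 0 < ((Nat.gcd (p.1 * p'.2) (p'.1 * p.2) : ℕ) : ℝ) := by
    have : 0 < p.1 * p'.2 := by
      have := (mem_mollRange.mp (Finset.mem_product.mp hp).1).1
      have := (mem_mollRange.mp (Finset.mem_product.mp hp').2).1
      positivity
    exact_mod_cast Nat.gcd_pos_of_pos_left _ this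
  have hρ : 0 < ρq := by positivity
  set w : ℝ := (p.1 : ℝ) * p'.1 / Nat.gcd (p.1 * p'.2) (p'.1 * p.2) with hw
  have hw0 : 0 < w := by positivity
  have hwρ : w = ρq⁻¹ := by rw [hw, inv_div]
  have hs : 0 < 2 * π * Real.sin δ := by positivity
  have heta : etaDiag δ p p' = (2 * π * Real.sin δ) * w ^ 2 := by rw [etaDiag, hw]; ring
  refine ⟨by rw [heta]; positivity, hρ, ?_, ?_⟩
  · rw [heta, Real.sqrt_mul hs.le, Real.sqrt_sq hw0.le, hwρ, mul_inv, inv_inv, div_eq_mul_inv, mul_comm]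
  · rw [heta, Real.mul_rpow hs.le (by positivity), show (w ^ 2 : ℝ) = w ^ (2 : ℝ) by norm_cast,
      ← Real.rpow_mul hw0.le, hwρ, Real.inv_rpow hρ.le, ← Real.rpow_neg hρ.le]
    congr 1
    ring_nf

/-- **Titchmarsh (10.11.1)**: the diagonal is `S(0)√π/(2θx^θ√(2π sin δ)) + c(θ)(2π sin δ)^{(θ-1)/2} S(θ)`
up to `12 x^{1-θ} (∑_p|c_p|)²` (`x ≥ 1`, `0 < θ ≤ ½`). [cite: Titchmarsh1986, §10.11 (10.11.1)] -/
theorem abs_diag_sub_main_le (hδ : 0 < Real.sin δ) (hx : 1 ≤ x) (hθ : 0 < θ) (hθ1 : θ ≤ 1 / 2) :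
    |(∑ p ∈ mollRange X ×ˢ mollRange X, ∑ p' ∈ mollRange X ×ˢ mollRange X,
        gCoeff X p * gCoeff X p' * Wsum (etaDiag δ p p') x θ) -
      Real.sqrt π / (2 * θ * x ^ θ * Real.sqrt (2 * π * Real.sin δ)) * Squad X 0 -
      cW θ * (2 * π * Real.sin δ) ^ ((θ - 1) / 2) * Squad X θ| ≤
      12 * x ^ (1 - θ) * (∑ p ∈ mollRange X ×ˢ mollRange X, |gCoeff X p|) ^ 2 := by
  set R := mollRange X ×ˢ mollRange X with hR
  set ρq : ℕ × ℕ → ℕ × ℕ → ℝ := fun p p' ↦ (Nat.gcd (p.1 * p'.2) (p'.1 * p.2) : ℝ) / ((p.1 : ℝ) * p'.1) with hρq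
  -- rewrite the two quadratic forms in the `g`-indexing
  have hS0 : Squad X 0 = ∑ p ∈ R, ∑ p' ∈ R, gCoeff X p * gCoeff X p' * ρq p p' := by
    rw [← sum_gCoeff_ratio_eq_Squad X 0]
    refine Finset.sum_congr rfl fun p _ ↦ Finset.sum_congr rfl fun p' _ ↦ ?_
    rw [sub_zero, Real.rpow_one]
  have hSθ : Squad X θ = ∑ p ∈ R, ∑ p' ∈ R, gCoeff X p * gCoeff X p' * ρq p p' ^ (1 - θ) :=
    (sum_gCoeff_ratio_eq_Squad X θ).symm
  rw [hS0, hSθ, Finset.mul_sum, Finset.mul_sum, ← Finset.sum_sub_distrib, ← Finset.sum_sub_distrib]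
  have hinner : ∀ p ∈ R,
      (∑ p' ∈ R, gCoeff X p * gCoeff X p' * Wsum (etaDiag δ p p') x θ) -
        Real.sqrt π / (2 * θ * x ^ θ * Real.sqrt (2 * π * Real.sin δ)) * ∑ p' ∈ R, gCoeff X p * gCoeff X p' * ρq p p' -
        cW θ * (2 * π * Real.sin δ) ^ ((θ - 1) / 2) * ∑ p' ∈ R, gCoeff X p * gCoeff X p' * ρq p p' ^ (1 - θ) =
      ∑ p' ∈ R, gCoeff X p * gCoeff X p' * (Wsum (etaDiag δ p p') x θ -
        Real.sqrt π / (2 * θ * x ^ θ * Real.sqrt (etaDiag δ p p')) - cW θ * etaDiag δ p p' ^ ((θ - 1) / 2)) := by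
    intro p hp
    rw [Finset.mul_sum, Finset.mul_sum, ← Finset.sum_sub_distrib, ← Finset.sum_sub_distrib]
    refine Finset.sum_congr rfl fun p' hp' ↦ ?_
    obtain ⟨heta, hρ, hsqrt, hpow⟩ := etaDiag_facts hδ hp hp' θ
    have h1 : Real.sqrt π / (2 * θ * x ^ θ * Real.sqrt (etaDiag δ p p')) =
        Real.sqrt π / (2 * θ * x ^ θ * Real.sqrt (2 * π * Real.sin δ)) * ρq p p' := by
      rw [div_eq_mul_inv, mul_inv, hsqrt, hρq]
      field_simp
    rw [h1, hpow]
    ring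
  rw [Finset.sum_congr rfl hinner]
  calc |∑ p ∈ R, ∑ p' ∈ R, gCoeff X p * gCoeff X p' * (Wsum (etaDiag δ p p') x θ -
          Real.sqrt π / (2 * θ * x ^ θ * Real.sqrt (etaDiag δ p p')) - cW θ * etaDiag δ p p' ^ ((θ - 1) / 2))|
      ≤ ∑ p ∈ R, ∑ p' ∈ R, |gCoeff X p| * |gCoeff X p'| * (12 * x ^ (1 - θ)) := by
        refine (Finset.abs_sum_le_sum_abs _ _).trans (Finset.sum_le_sum fun p hp ↦ ?_)
        refine (Finset.abs_sum_le_sum_abs _ _).trans (Finset.sum_le_sum fun p' hp' ↦ ?_)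
        rw [abs_mul, abs_mul]
        exact mul_le_mul_of_nonneg_left (abs_Wsum_sub_le (etaDiag_facts hδ hp hp' θ).1 hx hθ hθ1) (by positivity)
    _ = 12 * x ^ (1 - θ) * (∑ p ∈ R, |gCoeff X p|) ^ 2 := by
        rw [sq, Finset.sum_mul_sum, Finset.mul_sum]
        refine Finset.sum_congr rfl fun p _ ↦ ?_
        rw [Finset.mul_sum]
        refine Finset.sum_congr rfl fun p' _ ↦ ?_
        ring

end MainTerms

/-! ## §7 (10.15.1) and (10.17.2): the bound for `J(x,θ)` -/

set_option maxHeartbeats 400000 in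
/-- **Titchmarsh (10.17.2)** — `J(x,θ) = O(1/(δ^{1/2} θ x^θ log X))` under the side conditions of
§10.15–10.16. Precisely: there are absolute constants `K, C₂ > 0` such that for `X ≥ 3`, `0 < δ ≤ 1`,
`0 < θ ≤ ½`, `x ≥ 1` satisfying `x X² (2πδ)^{1/2} ≤ 1`, `24 x X² (1 + log X)³ δ^{1/2} ≤ 1` and
`C₂ X⁴ (1 + log X + log(1/δ))⁴ δ^{1/2} ≤ 1`, one has `J(x,θ) ≤ K/(θ x^θ δ^{1/2} log X)`.
(For `X = δ^{-c}`, `x ≤ X^{2a}`, `(a+2)c ≤ ¼`, `c < ⅛` the conditions hold for `δ ≤ δ₀(a,c)`.)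
[cite: Titchmarsh1986, §10.15 (10.15.1), §10.17 (10.17.2)] -/
theorem Jint_le :
    ∃ K C₂ : ℝ, 0 < K ∧ 0 < C₂ ∧ ∀ X : ℝ, 3 ≤ X → ∀ δ : ℝ, 0 < δ → δ ≤ 1 → ∀ θ : ℝ, 0 < θ → θ ≤ 1 / 2 →
      ∀ x : ℝ, 1 ≤ x → x * X ^ 2 * Real.sqrt (2 * π * δ) ≤ 1 →
        24 * x * X ^ 2 * (1 + Real.log X) ^ 3 * Real.sqrt δ ≤ 1 →
        C₂ * X ^ 4 * (1 + Real.log X + Real.log (1 / δ)) ^ 4 * Real.sqrt δ ≤ 1 →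
        Jint X δ x θ ≤ K / (θ * x ^ θ * Real.sqrt δ * Real.log X) := by
  obtain ⟨C, hC, hS⟩ := Squad_le
  obtain ⟨C₂, hC₂, hSig⟩ := norm_Sigma2_le
  refine ⟨12 * C + 2, C₂, by positivity, hC₂, fun X hX δ hδ hδ1 θ hθ hθ1 x hx hc1 hc2 hc3 ↦ ?_⟩
  obtain ⟨hsin, hcos⟩ := sin_cos_bounds hδ hδ1
  have hsin0 : 0 < Real.sin δ := by linarith
  have hsinle : Real.sin δ ≤ δ := Real.sin_le hδ.le
  have hX0 : 0 < X := by linarith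
  have hX1 : 1 ≤ X := by linarith
  have hX2 : 2 ≤ X := by linarith
  have hx0 : 0 < x := by linarith
  have hlog1 : 1 ≤ Real.log X := by
    rw [Real.le_log_iff_exp_le hX0]; have := Real.exp_one_lt_d9; linarith
  have hlog0 : 0 < Real.log X := by linarith
  have hsδ : 0 < Real.sqrt δ := Real.sqrt_pos.mpr hδ
  have hxθ : 0 < x ^ θ := Real.rpow_pos_of_pos hx0 θ
  set D : ℝ := θ * x ^ θ * Real.sqrt δ * Real.log X with hD
  have hD0 : 0 < D := by positivity
  set L : ℝ := 1 + Real.log X + Real.log (1 / δ) with hL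
  have hlogδ : 0 ≤ Real.log (1 / δ) := Real.log_nonneg (by rw [le_div_iff₀ hδ]; linarith)
  have hL1 : Real.log X ≤ L := by rw [hL]; linarith
  have hL0 : 0 < L := by linarith
  -- `J = re(Σ₁) + re(Σ₂)`
  have hJ : Jint X δ x θ = (Jdiag X δ x θ).re + (Sigma2 X δ x θ).re := by
    have h := Jint_eq_Jsum hX0 hsin0 hx hθ.le
    rw [Jsum_eq_Jdiag_add_Sigma2 hsin0 hx hθ.le] at h
    have := congrArg Complex.re h
    simpa using this
  rw [hJ, Jdiag_eq, Complex.ofReal_re]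
  set Sd := ∑ p ∈ mollRange X ×ˢ mollRange X, ∑ p' ∈ mollRange X ×ˢ mollRange X,
    gCoeff X p * gCoeff X p' * Wsum (etaDiag δ p p') x θ with hSd
  have hmain := abs_diag_sub_main_le (X := X) hsin0 hx hθ hθ1
  rw [← hSd] at hmain
  have hS0 := hS X hX 0 le_rfl zero_le_one
  rw [mul_zero, Real.rpow_zero, mul_one] at hS0
  have hSθ := hS X hX θ hθ.le (by linarith)
  have hS0nn : 0 ≤ Squad X 0 := Squad_nonneg zero_le_one
  have hSθnn : 0 ≤ Squad X θ := Squad_nonneg (by linarith)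
  have hs : 0 < 2 * π * Real.sin δ := by positivity
  have hsqrt_s : Real.sqrt δ ≤ Real.sqrt (2 * π * Real.sin δ) := Real.sqrt_le_sqrt (by nlinarith [Real.pi_gt_three])
  have hsqrt_s0 : 0 < Real.sqrt (2 * π * Real.sin δ) := Real.sqrt_pos.mpr hs
  -- (1) the `S(0)` term
  have h1 : Real.sqrt π / (2 * θ * x ^ θ * Real.sqrt (2 * π * Real.sin δ)) * Squad X 0 ≤ C / D := by
    have hsπ : Real.sqrt π ≤ 2 := by
      rw [Real.sqrt_le_left (by norm_num)]; linarith [Real.pi_lt_four]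
    calc Real.sqrt π / (2 * θ * x ^ θ * Real.sqrt (2 * π * Real.sin δ)) * Squad X 0
        ≤ 2 / (2 * θ * x ^ θ * Real.sqrt δ) * (C / Real.log X) := by
          refine mul_le_mul ?_ hS0 hS0nn (by positivity)
          exact div_le_div₀ (by norm_num) hsπ (by positivity) (by gcongr)
      _ = C / D := by rw [hD]; field_simp
  -- (2) the `S(θ)` term, using `x X² √(2πδ) ≤ 1`
  have h2 : |cW θ * (2 * π * Real.sin δ) ^ ((θ - 1) / 2) * Squad X θ| ≤ 11 * C / D := by
    have hpow : (2 * π * Real.sin δ) ^ ((θ - 1) / 2) = (Real.sqrt (2 * π * Real.sin δ))⁻¹ *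
        (Real.sqrt (2 * π * Real.sin δ)) ^ θ := by
      rw [Real.sqrt_eq_rpow, ← Real.rpow_neg_one, ← Real.rpow_mul hs.le, ← Real.rpow_mul hs.le,
        ← Real.rpow_add hs]
      ring_nf
    have hsq : Real.sqrt (2 * π * Real.sin δ) ≤ Real.sqrt (2 * π * δ) := Real.sqrt_le_sqrt (by nlinarith [Real.pi_pos])
    have hkey : X ^ (2 * θ) * (Real.sqrt (2 * π * Real.sin δ)) ^ θ ≤ (x ^ θ)⁻¹ := by
      have hb : X ^ (2 * θ) * (Real.sqrt (2 * π * Real.sin δ)) ^ θ ≤ (X ^ 2 * Real.sqrt (2 * π * δ)) ^ θ := by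
        rw [Real.mul_rpow (by positivity) (Real.sqrt_nonneg _), show (X ^ 2 : ℝ) = X ^ (2 : ℝ) by norm_cast,
          ← Real.rpow_mul hX0.le]
        exact mul_le_mul_of_nonneg_left (Real.rpow_le_rpow (Real.sqrt_nonneg _) hsq hθ.le) (by positivity)
      have hle : X ^ 2 * Real.sqrt (2 * π * δ) ≤ x⁻¹ := by
        rw [inv_eq_one_div, le_div_iff₀ hx0]
        calc X ^ 2 * Real.sqrt (2 * π * δ) * x = x * X ^ 2 * Real.sqrt (2 * π * δ) := by ring
          _ ≤ 1 := hc1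
      have hc : (X ^ 2 * Real.sqrt (2 * π * δ)) ^ θ ≤ (x⁻¹) ^ θ := Real.rpow_le_rpow (by positivity) hle hθ.le
      rw [Real.inv_rpow hx0.le] at hc
      exact hb.trans hc
    have hcW := abs_cW_le hθ hθ1
    rw [abs_mul, abs_mul, abs_of_pos (Real.rpow_pos_of_pos hs _), abs_of_nonneg hSθnn, hpow]
    calc |cW θ| * ((Real.sqrt (2 * π * Real.sin δ))⁻¹ * Real.sqrt (2 * π * Real.sin δ) ^ θ) * Squad X θ
        ≤ (11 / θ) * ((Real.sqrt δ)⁻¹ * Real.sqrt (2 * π * Real.sin δ) ^ θ) * (C * X ^ (2 * θ) / Real.log X) := by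
          refine mul_le_mul (mul_le_mul hcW (mul_le_mul_of_nonneg_right (inv_anti₀ hsδ hsqrt_s)
            (by positivity)) (by positivity) (by positivity)) hSθ hSθnn (by positivity)
      _ = (11 * C / (θ * Real.sqrt δ * Real.log X)) * (X ^ (2 * θ) * Real.sqrt (2 * π * Real.sin δ) ^ θ) := by
          field_simp
      _ ≤ (11 * C / (θ * Real.sqrt δ * Real.log X)) * (x ^ θ)⁻¹ := mul_le_mul_of_nonneg_left hkey (by positivity)
      _ = 11 * C / D := by rw [hD]; field_simp
  -- (3) the error `12 x^{1-θ} (∑|c|)² ≤ 1/D`, using `24 x X² (1+log X)³ √δ ≤ 1`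
  have h3 : 12 * x ^ (1 - θ) * (∑ p ∈ mollRange X ×ˢ mollRange X, |gCoeff X p|) ^ 2 ≤ 1 / D := by
    have hsum := sum_abs_gCoeff_le hX1
    have hsum0 : 0 ≤ ∑ p ∈ mollRange X ×ˢ mollRange X, |gCoeff X p| := Finset.sum_nonneg fun _ _ ↦ abs_nonneg _
    have hsq : (∑ p ∈ mollRange X ×ˢ mollRange X, |gCoeff X p|) ^ 2 ≤ (2 * X * (1 + Real.log X)) ^ 2 :=
      pow_le_pow_left₀ hsum0 hsum 2
    have hx1θ : x ^ (1 - θ) * x ^ θ = x := by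
      rw [← Real.rpow_add hx0]; ring_nf; exact Real.rpow_one x
    rw [le_div_iff₀ hD0, hD]
    calc 12 * x ^ (1 - θ) * (∑ p ∈ mollRange X ×ˢ mollRange X, |gCoeff X p|) ^ 2 *
          (θ * x ^ θ * Real.sqrt δ * Real.log X)
        ≤ 12 * x ^ (1 - θ) * (2 * X * (1 + Real.log X)) ^ 2 * ((1 / 2) * x ^ θ * Real.sqrt δ * (1 + Real.log X)) := by
          refine mul_le_mul (mul_le_mul_of_nonneg_left hsq (by positivity)) ?_ (by positivity) (by positivity)
          refine mul_le_mul (mul_le_mul (mul_le_mul_of_nonneg_right hθ1 (by positivity)) le_rfl (by positivity)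
            (by positivity)) (by linarith) hlog0.le (by positivity)
      _ = 24 * x * X ^ 2 * (1 + Real.log X) ^ 3 * Real.sqrt δ := by
          rw [show 12 * x ^ (1 - θ) * (2 * X * (1 + Real.log X)) ^ 2 * (1 / 2 * x ^ θ * Real.sqrt δ * (1 + Real.log X)) =
            24 * (x ^ (1 - θ) * x ^ θ) * X ^ 2 * (1 + Real.log X) ^ 3 * Real.sqrt δ by ring, hx1θ]
      _ ≤ 1 := hc2
  -- (4) the off-diagonal `‖Σ₂‖ ≤ 1/D`, using `C₂ X⁴ L⁴ √δ ≤ 1`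
  have h4 : (Sigma2 X δ x θ).re ≤ 1 / D := by
    refine (Complex.re_le_norm _).trans ((hSig X hX2 δ hδ hδ1 x hx θ hθ.le).trans ?_)
    rw [le_div_iff₀ hD0, hD, ← hL]
    have hxx : x ^ (-θ) * x ^ θ = 1 := by rw [← Real.rpow_add hx0, neg_add_cancel, Real.rpow_zero]
    calc C₂ * X ^ 4 * L ^ 3 * x ^ (-θ) * (θ * x ^ θ * Real.sqrt δ * Real.log X)
        = C₂ * X ^ 4 * L ^ 3 * (x ^ (-θ) * x ^ θ) * θ * Real.sqrt δ * Real.log X := by ring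
      _ = C₂ * X ^ 4 * L ^ 3 * θ * Real.sqrt δ * Real.log X := by rw [hxx]; ring
      _ ≤ C₂ * X ^ 4 * L ^ 3 * 1 * Real.sqrt δ * L := by gcongr; linarith
      _ = C₂ * X ^ 4 * L ^ 4 * Real.sqrt δ := by ring
      _ ≤ 1 := hc3
  -- assemble
  have habs := abs_le.mp hmain
  have habs2 := abs_le.mp h2
  have : Sd ≤ Real.sqrt π / (2 * θ * x ^ θ * Real.sqrt (2 * π * Real.sin δ)) * Squad X 0 +
      |cW θ * (2 * π * Real.sin δ) ^ ((θ - 1) / 2) * Squad X θ| +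
      12 * x ^ (1 - θ) * (∑ p ∈ mollRange X ×ˢ mollRange X, |gCoeff X p|) ^ 2 := by
    have := le_abs_self (cW θ * (2 * π * Real.sin δ) ^ ((θ - 1) / 2) * Squad X θ)
    linarith [habs.2]
  have hK : (12 * C + 2) / D = C / D + 11 * C / D + 1 / D + 1 / D := by field_simp; ring
  rw [hK]
  linarith

end Literature.NumberTheory.LFunctions.SelbergMollifier
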